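import Mathlib
import HarnessLib
import Summits.QuantumAdvantage.QuantumAdvantage.Theses.RegulatorThird
import Literature.Computability.Complexity.StringEquality
import Literature.Computability.Complexity.ReductionsProofs

/-!
# Line `denominator-split` for crux `OneThirdFP` (stmt-QuantumAdvantage-15982) — registered skeleton

Three stubs = the three children of the strategist's typed split (statements verbatim as in
`Cruxes/OneThirdFP/SPLIT-CHILDREN.md` / `children.json`), composition `OneThirdFP_of` = the glue theorem
`oneThirdFP_of_subs` of `Cruxes/OneThirdFP/SplitGlue.lean` (kernel-checked, no sorry outside the stubs).
Card: `Lines/denominator-split.md`.  Rationale, arithmetic and data: `Cruxes/OneThirdFP/SPLIT-RATIONALE.md`.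

* `stub_leastRepDenominator` (support, arithmetic, M) — denominators of least representatives are ramified:
  `n = b²` or `2b²`, `b` square-free, `b ∣ 2s`.
* `stub_leastDenominatorFP` (crux, the exposed core) — the denominator `n*` is `FP`-computable from `⟨bin s, bin r⟩`
  (= locating the optimal ambiguous class; genus / factoring-type; birth skeleton `Lines/birth-LeastDenominatorFP.lean`).
* `stub_canonicalRepGivenDenominatorFP` (crux, the infrastructure theorem) — given `n*`, the least triple is
  `FP`-computable (birth skeleton `Lines/birth-CanonicalRepGivenDenominatorFP.lean`).
-/

set_option linter.dupNamespace false

namespace Summit.QuantumAdvantage.QuantumAdvantage.Cruxes.OneThirdFP.DenominatorSplit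

open Literature.Computability.Complexity

/-- STUB 1 (support, arithmetic): denominators of least representatives are ramified squares. -/
theorem stub_leastRepDenominator :
    ∀ (s : ℕ), Squarefree s → 1 < s → ∀ (A B : ℤ) (n : ℕ), ((0 < n ∧ ∀ (K : Type) [Field K] [NumberField K], Module.finrank ℚ K = 2 → ∀ α : K, α ^ 2 = (s : K) → ∀ u : (NumberField.RingOfIntegers K)ˣ, (∀ v : (NumberField.RingOfIntegers K)ˣ, ∃ m : ℤ, v = u ^ m ∨ v = -(u ^ m)) → ∃ z : K, z ≠ 0 ∧ (((A : K) + (B : K) * α) / (n : K) = ((u : NumberField.RingOfIntegers K) : K) * z ^ 3 ∨ ((A : K) + (B : K) * α) / (n : K) = ((u⁻¹ : (NumberField.RingOfIntegers K)ˣ) : NumberField.RingOfIntegers K) * z ^ 3)) ∧ ∀ (A' B' : ℤ) (n' : ℕ), (0 < n' ∧ ∀ (K : Type) [Field K] [NumberField K], Module.finrank ℚ K = 2 → ∀ α : K, α ^ 2 = (s : K) → ∀ u : (NumberField.RingOfIntegers K)ˣ, (∀ v : (NumberField.RingOfIntegers K)ˣ, ∃ m : ℤ, v = u ^ m ∨ v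 = -(u ^ m)) → ∃ z : K, z ≠ 0 ∧ (((A' : K) + (B' : K) * α) / (n' : K) = ((u : NumberField.RingOfIntegers K) : K) * z ^ 3 ∨ ((A' : K) + (B' : K) * α) / (n' : K) = ((u⁻¹ : (NumberField.RingOfIntegers K)ˣ) : NumberField.RingOfIntegers K) * z ^ 3)) → (|A| + |B| + n < |A'| + |B'| + n' ∨ (|A| + |B| + n = |A'| + |B'| + n' ∧ (A < A' ∨ (A = A' ∧ (B < B' ∨ (B = B' ∧ n ≤ n'))))))) → ∃ b : ℕ, Squarefree b ∧ b ∣ 2 * s ∧ (n = b ^ 2 ∨ n = 2 * b ^ 2) := by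
  sorry

/-- STUB 2 (crux, exposed core): the denominator of the least representative is `FP`-computable from `⟨s, r⟩`. -/
theorem stub_leastDenominatorFP :
    ∃ f ∈ Literature.Computability.Complexity.FP, ∀ (s r : ℕ), Squarefree s → 1 < s → (∀ (K : Type) [Field K] [NumberField K], Module.finrank ℚ K = 2 → (∃ α : K, α ^ 2 = (s : K)) → |NumberField.Units.regulator K - (r : ℝ)| ≤ 1) → ∀ (A B : ℤ) (n : ℕ), ((0 < n ∧ ∀ (K : Type) [Field K] [NumberField K], Module.finrank ℚ K = 2 → ∀ α : K, α ^ 2 = (s : K) → ∀ u : (NumberField.RingOfIntegers K)ˣ, (∀ v : (NumberField.RingOfIntegers K)ˣ, ∃ m : ℤ, v = u ^ m ∨ v = -(u ^ m)) → ∃ z : K, z ≠ 0 ∧ (((A : K) + (B : K) * α) / (n : K) = ((u : NumberField.RingOfIntegers K) : K) * z ^ 3 ∨ ((A : K) + (B : K) * α) / (n : K) = ((u⁻¹ : (NumberField.RingOfIntegers K)ˣ) : NumberField.RingOfIntegers K) * z ^ 3)) ∧ ∀ (A' B' : ℤ) (n' : ℕ), (0 < n' ∧ ∀ (K : Type) [Field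 K] [NumberField K], Module.finrank ℚ K = 2 → ∀ α : K, α ^ 2 = (s : K) → ∀ u : (NumberField.RingOfIntegers K)ˣ, (∀ v : (NumberField.RingOfIntegers K)ˣ, ∃ m : ℤ, v = u ^ m ∨ v = -(u ^ m)) → ∃ z : K, z ≠ 0 ∧ (((A' : K) + (B' : K) * α) / (n' : K) = ((u : NumberField.RingOfIntegers K) : K) * z ^ 3 ∨ ((A' : K) + (B' : K) * α) / (n' : K) = ((u⁻¹ : (NumberField.RingOfIntegers K)ˣ) : NumberField.RingOfIntegers K) * z ^ 3)) → (|A| + |B| + n < |A'| + |B'| + n' ∨ (|A| + |B| + n = |A'| + |B'| + n' ∧ (A < A' ∨ (A = A' ∧ (B < B' ∨ (B = B' ∧ n ≤ n'))))))) → f (Literature.Computability.Complexity.boolPair (Computability.encodeNat s) (Computability.encodeNat r)) = Computability.encodeNat n := by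
  sorry

/-- STUB 3 (crux, infrastructure): given the denominator as advice, the least representative is `FP`-computable. -/
theorem stub_canonicalRepGivenDenominatorFP :
    ∃ g ∈ Literature.Computability.Complexity.FP, ∀ (s r : ℕ), Squarefree s → 1 < s → (∀ (K : Type) [Field K] [NumberField K], Module.finrank ℚ K = 2 → (∃ α : K, α ^ 2 = (s : K)) → |NumberField.Units.regulator K - (r : ℝ)| ≤ 1) → ∀ (A B : ℤ) (n : ℕ), ((0 < n ∧ ∀ (K : Type) [Field K] [NumberField K], Module.finrank ℚ K = 2 → ∀ α : K, α ^ 2 = (s : K) → ∀ u : (NumberField.RingOfIntegers K)ˣ, (∀ v : (NumberField.RingOfIntegers K)ˣ, ∃ m : ℤ, v = u ^ m ∨ v = -(u ^ m)) → ∃ z : K, z ≠ 0 ∧ (((A : K) + (B : K) * α) / (n : K) = ((u : NumberField.RingOfIntegers K) : K) * z ^ 3 ∨ ((A : K) + (B : K) * α) / (n : K) = ((u⁻¹ : (NumberField.RingOfIntegers K)ˣ) : NumberField.RingOfIntegers K) * z ^ 3)) ∧ ∀ (A' B' : ℤ) (n' : ℕ), (0 < n' ∧ ∀ (K : Type) [Field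 K] [NumberField K], Module.finrank ℚ K = 2 → ∀ α : K, α ^ 2 = (s : K) → ∀ u : (NumberField.RingOfIntegers K)ˣ, (∀ v : (NumberField.RingOfIntegers K)ˣ, ∃ m : ℤ, v = u ^ m ∨ v = -(u ^ m)) → ∃ z : K, z ≠ 0 ∧ (((A' : K) + (B' : K) * α) / (n' : K) = ((u : NumberField.RingOfIntegers K) : K) * z ^ 3 ∨ ((A' : K) + (B' : K) * α) / (n' : K) = ((u⁻¹ : (NumberField.RingOfIntegers K)ˣ) : NumberField.RingOfIntegers K) * z ^ 3)) → (|A| + |B| + n < |A'| + |B'| + n' ∨ (|A| + |B| + n = |A'| + |B'| + n' ∧ (A < A' ∨ (A = A' ∧ (B < B' ∨ (B = B' ∧ n ≤ n'))))))) → (∃ b : ℕ, Squarefree b ∧ b ∣ 2 * s ∧ (n = b ^ 2 ∨ n = 2 * b ^ 2)) → g (Literature.Computability.Complexity.boolPair (Literature.Computability.Complexity.boolPair (Computability.encodeNat s) (Computability.encodeNat r)) (Computability.encodeNat n)) = Literature.Computability.Complexity.boolPair (Literature.Computability.Complexity.boolPair (Computability.encodeNat A.natAbs) (Computability.encodeNat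 B.natAbs)) (Literature.Computability.Complexity.boolPair (Computability.encodeNat n) [decide (A < 0), decide (B < 0)]) := by
  sorry

/-- COMPOSITION (= glue `oneThirdFP_of_subs`): the composite machine `g ∘ fanoutFn id f` is in `FP` and correct. -/
theorem OneThirdFP_of :
    (∀ (s : ℕ), Squarefree s → 1 < s → ∀ (A B : ℤ) (n : ℕ), ((0 < n ∧ ∀ (K : Type) [Field K] [NumberField K], Module.finrank ℚ K = 2 → ∀ α : K, α ^ 2 = (s : K) → ∀ u : (NumberField.RingOfIntegers K)ˣ, (∀ v : (NumberField.RingOfIntegers K)ˣ, ∃ m : ℤ, v = u ^ m ∨ v = -(u ^ m)) → ∃ z : K, z ≠ 0 ∧ (((A : K) + (B : K) * α) / (n : K) = ((u : NumberField.RingOfIntegers K) : K) * z ^ 3 ∨ ((A : K) + (B : K) * α) / (n : K) = ((u⁻¹ : (NumberField.RingOfIntegers K)ˣ) : NumberField.RingOfIntegers K) * z ^ 3)) ∧ ∀ (A' B' : ℤ) (n' : ℕ), (0 < n' ∧ ∀ (K : Type) [Field K] [NumberField K], Module.finrank ℚ K = 2 → ∀ α : K, α ^ 2 = (s : K) → ∀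 u : (NumberField.RingOfIntegers K)ˣ, (∀ v : (NumberField.RingOfIntegers K)ˣ, ∃ m : ℤ, v = u ^ m ∨ v = -(u ^ m)) → ∃ z : K, z ≠ 0 ∧ (((A' : K) + (B' : K) * α) / (n' : K) = ((u : NumberField.RingOfIntegers K) : K) * z ^ 3 ∨ ((A' : K) + (B' : K) * α) / (n' : K) = ((u⁻¹ : (NumberField.RingOfIntegers K)ˣ) : NumberField.RingOfIntegers K) * z ^ 3)) → (|A| + |B| + n < |A'| + |B'| + n' ∨ (|A| + |B| + n = |A'| + |B'| + n' ∧ (A < A' ∨ (A = A' ∧ (B < B' ∨ (B = B' ∧ n ≤ n'))))))) → ∃ b : ℕ, Squarefree b ∧ b ∣ 2 * s ∧ (n = b ^ 2 ∨ n = 2 * b ^ 2)) →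
    (∃ f ∈ Literature.Computability.Complexity.FP, ∀ (s r : ℕ), Squarefree s → 1 < s → (∀ (K : Type) [Field K] [NumberField K], Module.finrank ℚ K = 2 → (∃ α : K, α ^ 2 = (s : K)) → |NumberField.Units.regulator K - (r : ℝ)| ≤ 1) → ∀ (A B : ℤ) (n : ℕ), ((0 < n ∧ ∀ (K : Type) [Field K] [NumberField K], Module.finrank ℚ K = 2 → ∀ α : K, α ^ 2 = (s : K) → ∀ u : (NumberField.RingOfIntegers K)ˣ, (∀ v : (NumberField.RingOfIntegers K)ˣ, ∃ m : ℤ, v = u ^ m ∨ v = -(u ^ m)) → ∃ z : K, z ≠ 0 ∧ (((A : K) + (B : K) * α) / (n : K) = ((u : NumberField.RingOfIntegers K) : K) * z ^ 3 ∨ ((A : K) + (B : K) * α) / (n : K) = ((u⁻¹ : (NumberField.RingOfIntegers K)ˣ) : NumberField.RingOfIntegers K) * z ^ 3)) ∧ ∀ (A' B' : ℤ) (n' : ℕ), (0 < n' ∧ ∀ (K : Type) [Field K] [NumberField K], Module.finrank ℚ K = 2 → ∀ α : K, α ^ 2 = (s : K) → ∀ u : (NumberField.RingOfIntegers K)ˣ,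 (∀ v : (NumberField.RingOfIntegers K)ˣ, ∃ m : ℤ, v = u ^ m ∨ v = -(u ^ m)) → ∃ z : K, z ≠ 0 ∧ (((A' : K) + (B' : K) * α) / (n' : K) = ((u : NumberField.RingOfIntegers K) : K) * z ^ 3 ∨ ((A' : K) + (B' : K) * α) / (n' : K) = ((u⁻¹ : (NumberField.RingOfIntegers K)ˣ) : NumberField.RingOfIntegers K) * z ^ 3)) → (|A| + |B| + n < |A'| + |B'| + n' ∨ (|A| + |B| + n = |A'| + |B'| + n' ∧ (A < A' ∨ (A = A' ∧ (B < B' ∨ (B = B' ∧ n ≤ n'))))))) → f (Literature.Computability.Complexity.boolPair (Computability.encodeNat s) (Computability.encodeNat r)) = Computability.encodeNat n) →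
    (∃ g ∈ Literature.Computability.Complexity.FP, ∀ (s r : ℕ), Squarefree s → 1 < s → (∀ (K : Type) [Field K] [NumberField K], Module.finrank ℚ K = 2 → (∃ α : K, α ^ 2 = (s : K)) → |NumberField.Units.regulator K - (r : ℝ)| ≤ 1) → ∀ (A B : ℤ) (n : ℕ), ((0 < n ∧ ∀ (K : Type) [Field K] [NumberField K], Module.finrank ℚ K = 2 → ∀ α : K, α ^ 2 = (s : K) → ∀ u : (NumberField.RingOfIntegers K)ˣ, (∀ v : (NumberField.RingOfIntegers K)ˣ, ∃ m : ℤ, v = u ^ m ∨ v = -(u ^ m)) → ∃ z : K, z ≠ 0 ∧ (((A : K) + (B : K) * α) / (n : K) = ((u : NumberField.RingOfIntegers K) : K) * z ^ 3 ∨ ((A : K) + (B : K) * α) / (n : K) = ((u⁻¹ : (NumberField.RingOfIntegers K)ˣ) : NumberField.RingOfIntegers K) * z ^ 3)) ∧ ∀ (A' B' : ℤ) (n' : ℕ), (0 < n' ∧ ∀ (K : Type) [Field K] [NumberField K], Module.finrank ℚ K = 2 → ∀ α : K, α ^ 2 = (s : K) → ∀ u : (NumberField.RingOfIntegers K)ˣ,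 (∀ v : (NumberField.RingOfIntegers K)ˣ, ∃ m : ℤ, v = u ^ m ∨ v = -(u ^ m)) → ∃ z : K, z ≠ 0 ∧ (((A' : K) + (B' : K) * α) / (n' : K) = ((u : NumberField.RingOfIntegers K) : K) * z ^ 3 ∨ ((A' : K) + (B' : K) * α) / (n' : K) = ((u⁻¹ : (NumberField.RingOfIntegers K)ˣ) : NumberField.RingOfIntegers K) * z ^ 3)) → (|A| + |B| + n < |A'| + |B'| + n' ∨ (|A| + |B| + n = |A'| + |B'| + n' ∧ (A < A' ∨ (A = A' ∧ (B < B' ∨ (B = B' ∧ n ≤ n'))))))) → (∃ b : ℕ, Squarefree b ∧ b ∣ 2 * s ∧ (n = b ^ 2 ∨ n = 2 * b ^ 2)) → g (Literature.Computability.Complexity.boolPair (Literature.Computability.Complexity.boolPair (Computability.encodeNat s) (Computability.encodeNat r)) (Computability.encodeNat n)) = Literature.Computability.Complexity.boolPair (Literature.Computability.Complexity.boolPair (Computability.encodeNat A.natAbs) (Computability.encodeNat B.natAbs)) (Literature.Computability.Complexity.boolPair (Computability.encodeNat n) [decide (A < 0), decide (B < 0)])) →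
    Summit.QuantumAdvantage.QuantumAdvantage.Theses.RegulatorThird.OneThirdFP := by
  intro h0 h1 h2
  obtain ⟨f, hf, hfspec⟩ := h1
  obtain ⟨g, hg, hgspec⟩ := h2
  refine ⟨g ∘ fanoutFn id f, comp_mem_FP hg (fanoutFn_mem_FP (PolyTimeComputable.id _) hf), ?_⟩
  intro s r hs h1s hreg A B n hleast
  have e1 := hfspec s r hs h1s hreg A B n hleast
  have e0 := h0 s hs h1s A B n hleast
  have e2 := hgspec s r hs h1s hreg A B n hleast e0
  show g (fanoutFn id f (boolPair (Computability.encodeNat s) (Computability.encodeNat r))) = _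
  rw [fanoutFn_apply, id, e1]
  exact e2

/-- The crux from the three stubs (by name). -/
theorem OneThirdFP_holds_of_stubs : Summit.QuantumAdvantage.QuantumAdvantage.Theses.RegulatorThird.OneThirdFP :=
  OneThirdFP_of stub_leastRepDenominator stub_leastDenominatorFP stub_canonicalRepGivenDenominatorFP

end Summit.QuantumAdvantage.QuantumAdvantage.Cruxes.OneThirdFP.DenominatorSplit
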